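import Mathlib
import HarnessLib
import Summits.QuantumFields.YangMills.Theorems.LangevinControlUVFemtoCurvatureTwoPointOffAxisEngines

/-!
# Crux `FemtoCurvatureTwoPoint` (stmt-QuantumFields-9363): off-axis domination, part B — time-axis core (RP helper part 7)
`offAxis_core_pos` (registered sub-goal `stub_offAxisCorePos`): on `(ℤ/L)^d`, compact `G`, continuous `ρ`, `β ≥ 0`, planes
`q, q'`, `y₀ − x₀ ≡ m`, `1 ≤ m ≤ L/2`: `Cov(P_x^q,P_y^{q'})² ≤ (Σ_{s<3}|Cov(P_0^q,P_{(m−1+s)e₀}^q)|)·(Σ_{s<3}|Cov(P_0^{q'},P_{(m−1+s)e₀}^{q'})|)`;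
twenty placed-engine cases (part A `…OffAxisEngines`; table in the line's skeleton docstring of `stub_offAxisDomination`).
-/

noncomputable section

open MeasureTheory
open Literature.MathematicalPhysics.QuantumFieldTheory
namespace Summit.QuantumFields.YangMills.Theorems.FemtoCurvatureTwoPoint.AxisCovNonneg
section Engines
variable {d L N : ℕ} [NeZero d] [NeZero L] {G : Type*} [Group G] [TopologicalSpace G]
  [IsTopologicalGroup G] [CompactSpace G] [MeasurableSpace G] [BorelSpace G]
  (ρ : G →* Matrix (Fin N) (Fin N) ℂ)

/-- **The time-axis core of off-axis domination** (positive time separation). On `(ℤ/L)^{d+1}`, for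
every compact `G`, continuous `ρ`, `β ≥ 0`, planes `q, q'`, sites `x, y` with `y₀ − x₀ ≡ m`,
`1 ≤ m ≤ L/2`: `Cov(P_x^q, P_y^{q'})² ≤ W_q · W_{q'}` with the window sums
`W_q = Σ_{s<3} |Cov(P_0^q, P_{(m−1+s)e₀}^q)|`. Case table in the module docstring / NOTES. [folklore] -/
theorem offAxis_core_pos (hρ : Continuous ρ) {β : ℝ} (hβ : 0 ≤ β)
    (q q' : {p : Fin d × Fin d // p.1 < p.2}) (x y : Site d L) {m : ℕ} (hm1 : 1 ≤ m)
    (hmL : 2 * m ≤ L) (hΔ : y 0 - x 0 = ((m : ℕ) : ZMod L)) :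
    (wilsonExpectation ρ β (fun U => WilsonRP.plaqRe ρ U (((x, q) : Plaquette d L)) * WilsonRP.plaqRe ρ U (((y, q') : Plaquette d L))) - wilsonExpectation ρ β (fun U => WilsonRP.plaqRe ρ U (((x, q) : Plaquette d L))) * wilsonExpectation ρ β (fun U => WilsonRP.plaqRe ρ U (((y, q') : Plaquette d L)))) ^ 2 ≤
      (∑ s ∈ Finset.range 3, |(wilsonExpectation ρ β (fun U => WilsonRP.plaqRe ρ U ((((0 : Site d L), q) : Plaquette d L)) * WilsonRP.plaqRe ρ U (((Pi.single (0 : Fin d) (((m - 1 + s : ℕ) : ℕ) : ZMod L), q) : Plaquette d L))) - wilsonExpectation ρ β (fun U => WilsonRP.plaqRe ρ U ((((0 : Site d L), q) : Plaquette d L)))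
          * wilsonExpectation ρ β (fun U => WilsonRP.plaqRe ρ U (((Pi.single (0 : Fin d) (((m - 1 + s : ℕ) : ℕ) : ZMod L), q) : Plaquette d L))))|) *
      (∑ s ∈ Finset.range 3, |(wilsonExpectation ρ β (fun U => WilsonRP.plaqRe ρ U ((((0 : Site d L), q') : Plaquette d L)) * WilsonRP.plaqRe ρ U (((Pi.single (0 : Fin d) (((m - 1 + s : ℕ) : ℕ) : ZMod L), q') : Plaquette d L))) - wilsonExpectation ρ β (fun U => WilsonRP.plaqRe ρ U ((((0 : Site d L), q') : Plaquette d L)))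
          * wilsonExpectation ρ β (fun U => WilsonRP.plaqRe ρ U (((Pi.single (0 : Fin d) (((m - 1 + s : ℕ) : ℕ) : ZMod L), q') : Plaquette d L))))|) := by
  -- window membership of a signed separation
  have hwin : ∀ (r : {p : Fin d × Fin d // p.1 < p.2}) (c : ZMod L) (n : ℕ),
      (n = m - 1 ∨ n = m ∨ n = m + 1) → (c = ((n : ℕ) : ZMod L) ∨ c = -((n : ℕ) : ZMod L)) →
      |(wilsonExpectation ρ β (fun U => WilsonRP.plaqRe ρ U ((((0 : Site d L), r) : Plaquette d L)) * WilsonRP.plaqRe ρ U (((Pi.single (0 : Fin d) c, r) : Plaquette d L))) - wilsonExpectation ρ β (fun U => WilsonRP.plaqRe ρ U ((((0 : Site d L), r) : Plaquette d L)))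
          * wilsonExpectation ρ β (fun U => WilsonRP.plaqRe ρ U (((Pi.single (0 : Fin d) c, r) : Plaquette d L))))|
        ≤ ∑ s ∈ Finset.range 3, |(wilsonExpectation ρ β (fun U => WilsonRP.plaqRe ρ U ((((0 : Site d L), r) : Plaquette d L)) * WilsonRP.plaqRe ρ U (((Pi.single (0 : Fin d) (((m - 1 + s : ℕ) : ℕ) : ZMod L), r) : Plaquette d L))) - wilsonExpectation ρ β (fun U => WilsonRP.plaqRe ρ U ((((0 : Site d L), r) : Plaquette d L)))
            * wilsonExpectation ρ β (fun U => WilsonRP.plaqRe ρ U (((Pi.single (0 : Fin d) (((m - 1 + s : ℕ) : ℕ) : ZMod L), r) : Plaquette d L))))| := by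
    intro r c n hn hc
    have hval : |(wilsonExpectation ρ β (fun U => WilsonRP.plaqRe ρ U ((((0 : Site d L), r) : Plaquette d L)) * WilsonRP.plaqRe ρ U (((Pi.single (0 : Fin d) c, r) : Plaquette d L))) - wilsonExpectation ρ β (fun U => WilsonRP.plaqRe ρ U ((((0 : Site d L), r) : Plaquette d L)))
        * wilsonExpectation ρ β (fun U => WilsonRP.plaqRe ρ U (((Pi.single (0 : Fin d) c, r) : Plaquette d L))))| =
        |(wilsonExpectation ρ β (fun U => WilsonRP.plaqRe ρ U ((((0 : Site d L), r) : Plaquette d L)) * WilsonRP.plaqRe ρ U (((Pi.single (0 : Fin d) ((n : ℕ) : ZMod L), r) : Plaquette d L))) - wilsonExpectation ρ β (fun U => WilsonRP.plaqRe ρ U ((((0 : Site d L), r) : Plaquette d L)))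
            * wilsonExpectation ρ β (fun U => WilsonRP.plaqRe ρ U (((Pi.single (0 : Fin d) ((n : ℕ) : ZMod L), r) : Plaquette d L))))| := by
      rcases hc with rfl | rfl
      · rfl
      · rw [Pi.single_neg, cov_origin_neg ρ β _ r]
    rw [hval]
    obtain ⟨s, hs3, rfl⟩ : ∃ s, s < 3 ∧ n = m - 1 + s := by
      rcases hn with rfl | rfl | rfl
      · exact ⟨0, by norm_num, by omega⟩
      · exact ⟨1, by norm_num, by omega⟩
      · exact ⟨2, by norm_num, by omega⟩
    exact Finset.single_le_sum (f := fun s => |(wilsonExpectation ρ β (fun U => WilsonRP.plaqRe ρ U ((((0 : Site d L), r) : Plaquette d L)) * WilsonRP.plaqRe ρ U (((Pi.single (0 : Fin d) (((m - 1 + s : ℕ) : ℕ) : ZMod L), r) : Plaquette d L)))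
        - wilsonExpectation ρ β (fun U => WilsonRP.plaqRe ρ U ((((0 : Site d L), r) : Plaquette d L))) * wilsonExpectation ρ β (fun U => WilsonRP.plaqRe ρ U (((Pi.single (0 : Fin d) (((m - 1 + s : ℕ) : ℕ) : ZMod L), r) : Plaquette d L))))|)
      (fun _ _ => abs_nonneg _) (Finset.mem_range.2 hs3)
  -- closing a case from an engine output
  have hclose : ∀ (c₁ c₂ : ZMod L) (n₁ n₂ : ℕ),
      (n₁ = m - 1 ∨ n₁ = m ∨ n₁ = m + 1) → (c₁ = ((n₁ : ℕ) : ZMod L) ∨ c₁ = -((n₁ : ℕ) : ZMod L)) →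
      (n₂ = m - 1 ∨ n₂ = m ∨ n₂ = m + 1) → (c₂ = ((n₂ : ℕ) : ZMod L) ∨ c₂ = -((n₂ : ℕ) : ZMod L)) →
      (wilsonExpectation ρ β (fun U => WilsonRP.plaqRe ρ U (((x, q) : Plaquette d L)) * WilsonRP.plaqRe ρ U (((y, q') : Plaquette d L))) - wilsonExpectation ρ β (fun U => WilsonRP.plaqRe ρ U (((x, q) : Plaquette d L))) * wilsonExpectation ρ β (fun U => WilsonRP.plaqRe ρ U (((y, q') : Plaquette d L)))) ^ 2 ≤
        (wilsonExpectation ρ β (fun U => WilsonRP.plaqRe ρ U ((((0 : Site d L), q) : Plaquette d L)) * WilsonRP.plaqRe ρ U (((Pi.single (0 : Fin d) c₁, q) : Plaquette d L))) - wilsonExpectation ρ β (fun U => WilsonRP.plaqRe ρ U ((((0 : Site d L), q) : Plaquette d L)))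
            * wilsonExpectation ρ β (fun U => WilsonRP.plaqRe ρ U (((Pi.single (0 : Fin d) c₁, q) : Plaquette d L)))) *
        (wilsonExpectation ρ β (fun U => WilsonRP.plaqRe ρ U ((((0 : Site d L), q') : Plaquette d L)) * WilsonRP.plaqRe ρ U (((Pi.single (0 : Fin d) c₂, q') : Plaquette d L))) - wilsonExpectation ρ β (fun U => WilsonRP.plaqRe ρ U ((((0 : Site d L), q') : Plaquette d L)))
            * wilsonExpectation ρ β (fun U => WilsonRP.plaqRe ρ U (((Pi.single (0 : Fin d) c₂, q') : Plaquette d L)))) →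
      (wilsonExpectation ρ β (fun U => WilsonRP.plaqRe ρ U (((x, q) : Plaquette d L)) * WilsonRP.plaqRe ρ U (((y, q') : Plaquette d L))) - wilsonExpectation ρ β (fun U => WilsonRP.plaqRe ρ U (((x, q) : Plaquette d L))) * wilsonExpectation ρ β (fun U => WilsonRP.plaqRe ρ U (((y, q') : Plaquette d L)))) ^ 2 ≤
      (∑ s ∈ Finset.range 3, |(wilsonExpectation ρ β (fun U => WilsonRP.plaqRe ρ U ((((0 : Site d L), q) : Plaquette d L)) * WilsonRP.plaqRe ρ U (((Pi.single (0 : Fin d) (((m - 1 + s : ℕ) : ℕ) : ZMod L), q) : Plaquette d L))) - wilsonExpectation ρ β (fun U => WilsonRP.plaqRe ρ U ((((0 : Site d L), q) : Plaquette d L)))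
          * wilsonExpectation ρ β (fun U => WilsonRP.plaqRe ρ U (((Pi.single (0 : Fin d) (((m - 1 + s : ℕ) : ℕ) : ZMod L), q) : Plaquette d L))))|) *
      (∑ s ∈ Finset.range 3, |(wilsonExpectation ρ β (fun U => WilsonRP.plaqRe ρ U ((((0 : Site d L), q') : Plaquette d L)) * WilsonRP.plaqRe ρ U (((Pi.single (0 : Fin d) (((m - 1 + s : ℕ) : ℕ) : ZMod L), q') : Plaquette d L))) - wilsonExpectation ρ β (fun U => WilsonRP.plaqRe ρ U ((((0 : Site d L), q') : Plaquette d L)))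
          * wilsonExpectation ρ β (fun U => WilsonRP.plaqRe ρ U (((Pi.single (0 : Fin d) (((m - 1 + s : ℕ) : ℕ) : ZMod L), q') : Plaquette d L))))|) := by
    intro c₁ c₂ n₁ n₂ hn₁ hc₁ hn₂ hc₂ h
    have h1 := hwin q c₁ n₁ hn₁ hc₁
    have h2 := hwin q' c₂ n₂ hn₂ hc₂
    refine h.trans ((le_abs_self _).trans ?_)
    rw [abs_mul]
    exact mul_le_mul h1 h2 (abs_nonneg _) ((abs_nonneg _).trans h1)
  have hL2 : 2 ≤ L := by omega
  rcases Nat.even_or_odd L with ⟨r, hr⟩ | ⟨r, hr⟩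
  · have hLe : Even L := ⟨r, hr⟩
    rcases Nat.even_or_odd' m with ⟨k, hk | hk⟩
    · subst hk
      by_cases hq : q.1.1 = 0 <;> by_cases hq' : q'.1.1 = 0
      · -- (T,T), E3: link, a = b = k
        have h := placed_link ρ hLe hρ hβ q q' x y (k) (k)
          ((isPosPlaq_placed x (by omega) _).2 ⟨by omega, by simp [hq]; omega⟩)
          ((isPosPlaq_placed y (by omega) _).2 ⟨by omega, by simp [hq']; omega⟩)
          (by
            rw [plaqReflect_fst_zero_temporal (((Function.update x 0 ((k : ℕ) : ZMod L)), q) : Plaquette d L) hq]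
            simp only [Function.update_self]
            rw [hΔ]
            push_cast
            ring)
        rw [plaqReflect_fst_zero_temporal (((Function.update x 0 ((k : ℕ) : ZMod L)), q) : Plaquette d L) hq,
          plaqReflect_fst_zero_temporal (((Function.update y 0 ((k : ℕ) : ZMod L)), q') : Plaquette d L) hq'] at h
        simp only [Function.update_self] at h
        exact hclose _ _ (2 * k) (2 * k) (by omega) (Or.inl (by push_cast; ring)) (by omega) (Or.inl (by push_cast; ring)) h
      · -- (T,S), E8: link, a = b = k
        have h := placed_link ρ hLe hρ hβ q q' x y (k) (k)
          ((isPosPlaq_placed x (by omega) _).2 ⟨by omega, by simp [hq]; omega⟩)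
          ((isPosPlaq_placed y (by omega) _).2 ⟨by omega, by simp [hq']; omega⟩)
          (by
            rw [plaqReflect_fst_zero_temporal (((Function.update x 0 ((k : ℕ) : ZMod L)), q) : Plaquette d L) hq]
            simp only [Function.update_self]
            rw [hΔ]
            push_cast
            ring)
        rw [plaqReflect_fst_zero_temporal (((Function.update x 0 ((k : ℕ) : ZMod L)), q) : Plaquette d L) hq,
          plaqReflect_fst_zero_spatial (((Function.update y 0 ((k : ℕ) : ZMod L)), q') : Plaquette d L) hq'] at h
        simp only [Function.update_self] at h
        exact hclose _ _ (2 * k) (2 * k - 1) (by omega) (Or.inl (by push_cast; ring)) (by omega) (Or.inl (by rw [Nat.cast_sub (by omega)]; push_cast; ring)) h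
      · -- (S,T), E6: link, a = k + 1, b = k
        have h := placed_link ρ hLe hρ hβ q q' x y (k + 1) (k)
          ((isPosPlaq_placed x (by omega) _).2 ⟨by omega, by simp [hq]; omega⟩)
          ((isPosPlaq_placed y (by omega) _).2 ⟨by omega, by simp [hq']; omega⟩)
          (by
            rw [plaqReflect_fst_zero_spatial (((Function.update x 0 ((k + 1 : ℕ) : ZMod L)), q) : Plaquette d L) hq]
            simp only [Function.update_self]
            rw [hΔ]
            push_cast
            ring)
        rw [plaqReflect_fst_zero_spatial (((Function.update x 0 ((k + 1 : ℕ) : ZMod L)), q) : Plaquette d L) hq,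
          plaqReflect_fst_zero_temporal (((Function.update y 0 ((k : ℕ) : ZMod L)), q') : Plaquette d L) hq'] at h
        simp only [Function.update_self] at h
        exact hclose _ _ (2 * k + 1) (2 * k) (by omega) (Or.inl (by push_cast; ring)) (by omega) (Or.inl (by push_cast; ring)) h
      · -- (S,S), E2: site, a = b = k
        have h := placed_site ρ hLe hρ β q q' x y (k) (k)
          (Or.inl ((isSitePosPlaq_placed x (by omega) _).2 (by simp [hq]; omega)))
          (Or.inl ((isSitePosPlaq_placed y (by omega) _).2 (by simp [hq']; omega)))
          (by
            rw [sitePlaqReflect_fst_zero_spatial (((Function.update x 0 ((k : ℕ) : ZMod L)), q) : Plaquette d L) hq]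
            simp only [Function.update_self]
            rw [hΔ]
            push_cast
            ring)
        rw [sitePlaqReflect_fst_zero_spatial (((Function.update x 0 ((k : ℕ) : ZMod L)), q) : Plaquette d L) hq,
          sitePlaqReflect_fst_zero_spatial (((Function.update y 0 ((k : ℕ) : ZMod L)), q') : Plaquette d L) hq'] at h
        simp only [Function.update_self] at h
        exact hclose _ _ (2 * k) (2 * k) (by omega) (Or.inl (by push_cast; ring)) (by omega) (Or.inl (by push_cast; ring)) h
    · subst hk
      by_cases hq : q.1.1 = 0 <;> by_cases hq' : q'.1.1 = 0
      · -- (T,T), E4: site, a = b = k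
        have h := placed_site ρ hLe hρ β q q' x y (k) (k)
          (Or.inl ((isSitePosPlaq_placed x (by omega) _).2 (by simp [hq]; omega)))
          (Or.inl ((isSitePosPlaq_placed y (by omega) _).2 (by simp [hq']; omega)))
          (by
            rw [sitePlaqReflect_fst_zero_temporal (((Function.update x 0 ((k : ℕ) : ZMod L)), q) : Plaquette d L) hq]
            simp only [Function.update_self]
            rw [hΔ]
            push_cast
            ring)
        rw [sitePlaqReflect_fst_zero_temporal (((Function.update x 0 ((k : ℕ) : ZMod L)), q) : Plaquette d L) hq,
          sitePlaqReflect_fst_zero_temporal (((Function.update y 0 ((k : ℕ) : ZMod L)), q') : Plaquette d L) hq'] at h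
        simp only [Function.update_self] at h
        exact hclose _ _ (2 * k + 1) (2 * k + 1) (by omega) (Or.inl (by push_cast; ring)) (by omega) (Or.inl (by push_cast; ring)) h
      · -- (T,S), E7: link a = k, b = k + 1 (`k ≥ 1`); site a = b = 0 with `p'` in the plane (`k = 0`)
        rcases Nat.eq_zero_or_pos k with hk0 | hk0
        · subst hk0
          have h := placed_site ρ hLe hρ β q q' x y (0) (0)
            (Or.inl ((isSitePosPlaq_placed x (by omega) _).2 (by simp [hq]; omega)))
            (Or.inr ((isSharedPlaq_placed y (by omega) _).2 ⟨hq', by omega⟩))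
            (by
              rw [sitePlaqReflect_fst_zero_temporal (((Function.update x 0 ((0 : ℕ) : ZMod L)), q) : Plaquette d L) hq]
              simp only [Function.update_self]
              rw [hΔ]
              push_cast
              ring)
          rw [sitePlaqReflect_fst_zero_temporal (((Function.update x 0 ((0 : ℕ) : ZMod L)), q) : Plaquette d L) hq,
            sitePlaqReflect_fst_zero_spatial (((Function.update y 0 ((0 : ℕ) : ZMod L)), q') : Plaquette d L) hq'] at h
          simp only [Function.update_self] at h
          exact hclose _ _ (2 * 0 + 1) (2 * 0 + 1 - 1) (by omega) (Or.inl (by push_cast; ring)) (by omega) (Or.inl (by rw [Nat.cast_sub (by omega)]; push_cast; ring)) h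
        · -- `k ≥ 1`
          have h := placed_link ρ hLe hρ hβ q q' x y (k) (k + 1)
            ((isPosPlaq_placed x (by omega) _).2 ⟨by omega, by simp [hq]; omega⟩)
            ((isPosPlaq_placed y (by omega) _).2 ⟨by omega, by simp [hq']; omega⟩)
            (by
              rw [plaqReflect_fst_zero_temporal (((Function.update x 0 ((k : ℕ) : ZMod L)), q) : Plaquette d L) hq]
              simp only [Function.update_self]
              rw [hΔ]
              push_cast
              ring)
          rw [plaqReflect_fst_zero_temporal (((Function.update x 0 ((k : ℕ) : ZMod L)), q) : Plaquette d L) hq,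
            plaqReflect_fst_zero_spatial (((Function.update y 0 ((k + 1 : ℕ) : ZMod L)), q') : Plaquette d L) hq'] at h
          simp only [Function.update_self] at h
          exact hclose _ _ (2 * k + 1 - 1) (2 * k + 1) (by omega) (Or.inl (by rw [Nat.cast_sub (by omega)]; push_cast; ring)) (by omega) (Or.inl (by push_cast; ring)) h
      · -- (S,T), E5: link a = b = k + 1 (`k + 2 ≤ r`); else `L = 2`: site with `p` in the plane `t = 1`
        by_cases hkr : k + 2 ≤ r
        · have h := placed_link ρ hLe hρ hβ q q' x y (k + 1) (k + 1)
            ((isPosPlaq_placed x (by omega) _).2 ⟨by omega, by simp [hq]; omega⟩)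
            ((isPosPlaq_placed y (by omega) _).2 ⟨by omega, by simp [hq']; omega⟩)
            (by
              rw [plaqReflect_fst_zero_spatial (((Function.update x 0 ((k + 1 : ℕ) : ZMod L)), q) : Plaquette d L) hq]
              simp only [Function.update_self]
              rw [hΔ]
              push_cast
              ring)
          rw [plaqReflect_fst_zero_spatial (((Function.update x 0 ((k + 1 : ℕ) : ZMod L)), q) : Plaquette d L) hq,
            plaqReflect_fst_zero_temporal (((Function.update y 0 ((k + 1 : ℕ) : ZMod L)), q') : Plaquette d L) hq'] at h
          simp only [Function.update_self] at h
          exact hclose _ _ (2 * k + 1) (2 * k + 1 + 1) (by omega) (Or.inl (by push_cast; ring)) (by omega) (Or.inl (by push_cast; ring)) h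
        · have hk0 : k = 0 := by omega
          subst hk0
          have h := placed_site ρ hLe hρ β q q' x y (1) (0)
            (Or.inr ((isSharedPlaq_placed x (by omega) _).2 ⟨hq, by omega⟩))
            (Or.inl ((isSitePosPlaq_placed y (by omega) _).2 (by simp [hq']; omega)))
            (by
              rw [sitePlaqReflect_fst_zero_spatial (((Function.update x 0 ((1 : ℕ) : ZMod L)), q) : Plaquette d L) hq]
              simp only [Function.update_self]
              rw [hΔ]
              push_cast
              ring)
          rw [sitePlaqReflect_fst_zero_spatial (((Function.update x 0 ((1 : ℕ) : ZMod L)), q) : Plaquette d L) hq,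
            sitePlaqReflect_fst_zero_temporal (((Function.update y 0 ((0 : ℕ) : ZMod L)), q') : Plaquette d L) hq'] at h
          simp only [Function.update_self] at h
          exact hclose _ _ (2 * 0 + 1 + 1) (2 * 0 + 1) (by omega) (Or.inl (by push_cast; ring)) (by omega) (Or.inl (by push_cast; ring)) h
      · -- (S,S), E1: link, a = b = k + 1
        have h := placed_link ρ hLe hρ hβ q q' x y (k + 1) (k + 1)
          ((isPosPlaq_placed x (by omega) _).2 ⟨by omega, by simp [hq]; omega⟩)
          ((isPosPlaq_placed y (by omega) _).2 ⟨by omega, by simp [hq']; omega⟩)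
          (by
            rw [plaqReflect_fst_zero_spatial (((Function.update x 0 ((k + 1 : ℕ) : ZMod L)), q) : Plaquette d L) hq]
            simp only [Function.update_self]
            rw [hΔ]
            push_cast
            ring)
        rw [plaqReflect_fst_zero_spatial (((Function.update x 0 ((k + 1 : ℕ) : ZMod L)), q) : Plaquette d L) hq,
          plaqReflect_fst_zero_spatial (((Function.update y 0 ((k + 1 : ℕ) : ZMod L)), q') : Plaquette d L) hq'] at h
        simp only [Function.update_self] at h
        exact hclose _ _ (2 * k + 1) (2 * k + 1) (by omega) (Or.inl (by push_cast; ring)) (by omega) (Or.inl (by push_cast; ring)) h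
  · have hLo : Odd L := ⟨r, hr⟩
    have hL3 : 3 ≤ L := by omega
    have hL' : (((2 * r + 1 : ℕ) : ℕ) : ZMod L) = 0 := by rw [← hr]; exact ZMod.natCast_self L
    rcases Nat.even_or_odd' m with ⟨k, hk | hk⟩
    · subst hk
      by_cases hq : q.1.1 = 0 <;> by_cases hq' : q'.1.1 = 0
      · -- (T,T), O3: a = b = k
        have h := placed_odd ρ hLo hL3 hρ hβ q q' x y (k) (k)
          (Or.inl ((isOPosPlaq_placed x (by omega) _).2 ⟨by omega, by omega⟩))
          (Or.inl ((isOPosPlaq_placed y (by omega) _).2 ⟨by omega, by omega⟩))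
          (by
            rw [plaqReflect_fst_zero_temporal (((Function.update x 0 ((k : ℕ) : ZMod L)), q) : Plaquette d L) hq]
            simp only [Function.update_self]
            rw [hΔ]
            push_cast
            ring)
        rw [plaqReflect_fst_zero_temporal (((Function.update x 0 ((k : ℕ) : ZMod L)), q) : Plaquette d L) hq,
          plaqReflect_fst_zero_temporal (((Function.update y 0 ((k : ℕ) : ZMod L)), q') : Plaquette d L) hq'] at h
        simp only [Function.update_self] at h
        exact hclose _ _ (2 * k) (2 * k) (by omega) (Or.inl (by push_cast; ring)) (by omega) (Or.inl (by push_cast; ring)) h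
      · -- (T,S), O8: a = b = k
        have h := placed_odd ρ hLo hL3 hρ hβ q q' x y (k) (k)
          (Or.inl ((isOPosPlaq_placed x (by omega) _).2 ⟨by omega, by omega⟩))
          (Or.inl ((isOPosPlaq_placed y (by omega) _).2 ⟨by omega, by omega⟩))
          (by
            rw [plaqReflect_fst_zero_temporal (((Function.update x 0 ((k : ℕ) : ZMod L)), q) : Plaquette d L) hq]
            simp only [Function.update_self]
            rw [hΔ]
            push_cast
            ring)
        rw [plaqReflect_fst_zero_temporal (((Function.update x 0 ((k : ℕ) : ZMod L)), q) : Plaquette d L) hq,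
          plaqReflect_fst_zero_spatial (((Function.update y 0 ((k : ℕ) : ZMod L)), q') : Plaquette d L) hq'] at h
        simp only [Function.update_self] at h
        exact hclose _ _ (2 * k) (2 * k - 1) (by omega) (Or.inl (by push_cast; ring)) (by omega) (Or.inl (by rw [Nat.cast_sub (by omega)]; push_cast; ring)) h
      · -- (S,T), O6: a = k + 1, b = k
        have h := placed_odd ρ hLo hL3 hρ hβ q q' x y (k + 1) (k)
          (Or.inl ((isOPosPlaq_placed x (by omega) _).2 ⟨by omega, by omega⟩))
          (Or.inl ((isOPosPlaq_placed y (by omega) _).2 ⟨by omega, by omega⟩))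
          (by
            rw [plaqReflect_fst_zero_spatial (((Function.update x 0 ((k + 1 : ℕ) : ZMod L)), q) : Plaquette d L) hq]
            simp only [Function.update_self]
            rw [hΔ]
            push_cast
            ring)
        rw [plaqReflect_fst_zero_spatial (((Function.update x 0 ((k + 1 : ℕ) : ZMod L)), q) : Plaquette d L) hq,
          plaqReflect_fst_zero_temporal (((Function.update y 0 ((k : ℕ) : ZMod L)), q') : Plaquette d L) hq'] at h
        simp only [Function.update_self] at h
        exact hclose _ _ (2 * k + 1) (2 * k) (by omega) (Or.inl (by push_cast; ring)) (by omega) (Or.inl (by push_cast; ring)) h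
      · -- (S,S), O2: a = k, b = k + 1
        have h := placed_odd ρ hLo hL3 hρ hβ q q' x y (k) (k + 1)
          (Or.inl ((isOPosPlaq_placed x (by omega) _).2 ⟨by omega, by omega⟩))
          (Or.inl ((isOPosPlaq_placed y (by omega) _).2 ⟨by omega, by omega⟩))
          (by
            rw [plaqReflect_fst_zero_spatial (((Function.update x 0 ((k : ℕ) : ZMod L)), q) : Plaquette d L) hq]
            simp only [Function.update_self]
            rw [hΔ]
            push_cast
            ring)
        rw [plaqReflect_fst_zero_spatial (((Function.update x 0 ((k : ℕ) : ZMod L)), q) : Plaquette d L) hq,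
          plaqReflect_fst_zero_spatial (((Function.update y 0 ((k + 1 : ℕ) : ZMod L)), q') : Plaquette d L) hq'] at h
        simp only [Function.update_self] at h
        exact hclose _ _ (2 * k - 1) (2 * k + 1) (by omega) (Or.inl (by rw [Nat.cast_sub (by omega)]; push_cast; ring)) (by omega) (Or.inl (by push_cast; ring)) h
    · subst hk
      by_cases hq : q.1.1 = 0 <;> by_cases hq' : q'.1.1 = 0
      · -- (T,T), O4: swapped pair, a = b = r - k (separation `L - m ≡ -m`)
        have hkr : k ≤ r := by omega
        have hL'' : ((r : ℕ) : ZMod L) - k + ((r : ℕ) : ZMod L) - k + (2 * k + 1) = 0 := by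
          have := hL'
          push_cast at this ⊢
          linear_combination this
        have h := placed_odd ρ hLo hL3 hρ hβ q' q y x (r - k) (r - k)
          (Or.inl ((isOPosPlaq_placed y (by omega) _).2 ⟨by omega, by omega⟩))
          (Or.inl ((isOPosPlaq_placed x (by omega) _).2 ⟨by omega, by omega⟩))
          (by
            rw [plaqReflect_fst_zero_temporal (((Function.update y 0 ((r - k : ℕ) : ZMod L)), q') : Plaquette d L) hq']
            simp only [Function.update_self]
            rw [← neg_sub, hΔ]
            push_cast [Nat.cast_sub hkr]
            linear_combination (-1 : ZMod L) * hL'')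
        rw [plaqReflect_fst_zero_temporal (((Function.update y 0 ((r - k : ℕ) : ZMod L)), q') : Plaquette d L) hq',
          plaqReflect_fst_zero_temporal (((Function.update x 0 ((r - k : ℕ) : ZMod L)), q) : Plaquette d L) hq] at h
        simp only [Function.update_self] at h
        rw [covPair_symm ρ β ((y, q') : Plaquette d L) ((x, q) : Plaquette d L)] at h
        exact hclose _ _ (2 * k + 1) (2 * k + 1) (by omega) (Or.inr (by push_cast [Nat.cast_sub hkr]; linear_combination hL'')) (by omega) (Or.inr (by push_cast [Nat.cast_sub hkr]; linear_combination hL''))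
          (h.trans (le_of_eq (mul_comm _ _)))
      · -- (T,S), O7: a = k, b = k + 1 (`k ≥ 1`); `k = 0`: swapped pair with `p` in the shared slice
        rcases Nat.eq_zero_or_pos k with hk0 | hk0
        · subst hk0
          have hL'' : ((r : ℕ) : ZMod L) + r + 1 = 0 := by
            have := hL'
            push_cast at this ⊢
            linear_combination this
          have h := placed_odd ρ hLo hL3 hρ hβ q' q y x (r + 1) (r)
            (Or.inr ((isOSharedPlaq_placed y (by omega) _).2 ⟨hq', by omega⟩))
            (Or.inl ((isOPosPlaq_placed x (by omega) _).2 ⟨by omega, by omega⟩))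
            (by
              rw [plaqReflect_fst_zero_spatial (((Function.update y 0 ((r + 1 : ℕ) : ZMod L)), q') : Plaquette d L) hq']
              simp only [Function.update_self]
              rw [← neg_sub, hΔ]
              push_cast
              linear_combination (-1 : ZMod L) * hL'')
          rw [plaqReflect_fst_zero_spatial (((Function.update y 0 ((r + 1 : ℕ) : ZMod L)), q') : Plaquette d L) hq',
            plaqReflect_fst_zero_temporal (((Function.update x 0 ((r : ℕ) : ZMod L)), q) : Plaquette d L) hq] at h
          simp only [Function.update_self] at h
          rw [covPair_symm ρ β ((y, q') : Plaquette d L) ((x, q) : Plaquette d L)] at h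
          exact hclose _ _ (2 * 0 + 1) (2 * 0 + 1 - 1) (by omega) (Or.inr (by push_cast; linear_combination hL'')) (by omega) (Or.inl (by rw [Nat.cast_sub (by omega)]; push_cast; linear_combination hL''))
            (h.trans (le_of_eq (mul_comm _ _)))
        · -- `k ≥ 1`
          have h := placed_odd ρ hLo hL3 hρ hβ q q' x y (k) (k + 1)
            (Or.inl ((isOPosPlaq_placed x (by omega) _).2 ⟨by omega, by omega⟩))
            (Or.inl ((isOPosPlaq_placed y (by omega) _).2 ⟨by omega, by omega⟩))
            (by
              rw [plaqReflect_fst_zero_temporal (((Function.update x 0 ((k : ℕ) : ZMod L)), q) : Plaquette d L) hq]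
              simp only [Function.update_self]
              rw [hΔ]
              push_cast
              ring)
          rw [plaqReflect_fst_zero_temporal (((Function.update x 0 ((k : ℕ) : ZMod L)), q) : Plaquette d L) hq,
            plaqReflect_fst_zero_spatial (((Function.update y 0 ((k + 1 : ℕ) : ZMod L)), q') : Plaquette d L) hq'] at h
          simp only [Function.update_self] at h
          exact hclose _ _ (2 * k + 1 - 1) (2 * k + 1) (by omega) (Or.inl (by rw [Nat.cast_sub (by omega)]; push_cast; ring)) (by omega) (Or.inl (by push_cast; ring)) h
      · -- (S,T), O5: a = b = k + 1
        have h := placed_odd ρ hLo hL3 hρ hβ q q' x y (k + 1) (k + 1)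
          (Or.inl ((isOPosPlaq_placed x (by omega) _).2 ⟨by omega, by omega⟩))
          (Or.inl ((isOPosPlaq_placed y (by omega) _).2 ⟨by omega, by omega⟩))
          (by
            rw [plaqReflect_fst_zero_spatial (((Function.update x 0 ((k + 1 : ℕ) : ZMod L)), q) : Plaquette d L) hq]
            simp only [Function.update_self]
            rw [hΔ]
            push_cast
            ring)
        rw [plaqReflect_fst_zero_spatial (((Function.update x 0 ((k + 1 : ℕ) : ZMod L)), q) : Plaquette d L) hq,
          plaqReflect_fst_zero_temporal (((Function.update y 0 ((k + 1 : ℕ) : ZMod L)), q') : Plaquette d L) hq'] at h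
        simp only [Function.update_self] at h
        exact hclose _ _ (2 * k + 1) (2 * k + 1 + 1) (by omega) (Or.inl (by push_cast; ring)) (by omega) (Or.inl (by push_cast; ring)) h
      · -- (S,S), O1: a = b = k + 1
        have h := placed_odd ρ hLo hL3 hρ hβ q q' x y (k + 1) (k + 1)
          (Or.inl ((isOPosPlaq_placed x (by omega) _).2 ⟨by omega, by omega⟩))
          (Or.inl ((isOPosPlaq_placed y (by omega) _).2 ⟨by omega, by omega⟩))
          (by
            rw [plaqReflect_fst_zero_spatial (((Function.update x 0 ((k + 1 : ℕ) : ZMod L)), q) : Plaquette d L) hq]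
            simp only [Function.update_self]
            rw [hΔ]
            push_cast
            ring)
        rw [plaqReflect_fst_zero_spatial (((Function.update x 0 ((k + 1 : ℕ) : ZMod L)), q) : Plaquette d L) hq,
          plaqReflect_fst_zero_spatial (((Function.update y 0 ((k + 1 : ℕ) : ZMod L)), q') : Plaquette d L) hq'] at h
        simp only [Function.update_self] at h
        exact hclose _ _ (2 * k + 1) (2 * k + 1) (by omega) (Or.inl (by push_cast; ring)) (by omega) (Or.inl (by push_cast; ring)) h
end Engines
end Summit.QuantumFields.YangMills.Theorems.FemtoCurvatureTwoPoint.AxisCovNonneg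

namespace Summit.QuantumFields.YangMills.Theorems.FemtoCurvatureTwoPoint

/-- **Registered sub-goal `stub_offAxisCorePos`** (`--supports stmt-QuantumFields-9363`): time-axis core of
off-axis domination, positive separation (closed form of `AxisCovNonneg.offAxis_core_pos`). [folklore] -/
theorem stub_offAxisCorePos : ∀ (d L N : ℕ) [NeZero d] [NeZero L] (G : Type) [Group G] [TopologicalSpace G] [IsTopologicalGroup G] [CompactSpace G] [MeasurableSpace G] [BorelSpace G] (ρ : G →* Matrix (Fin N) (Fin N) ℂ), Continuous ρ → ∀ (β : ℝ), 0 ≤ β → ∀ (q q' : {p : Fin d × Fin d // p.1 < p.2}) (x y : Site d L) (m : ℕ), 1 ≤ m → 2 * m ≤ L → y 0 - x 0 = ((m : ℕ) : ZMod L) → (wilsonExpectation ρ β (fun U : GaugeConfig d L G => WilsonRP.plaqRe ρ U (((x, q)) : Plaquette d L) * WilsonRP.plaqRe ρ U (((y, q')) : Plaquette d L)) - wilsonExpectation ρ β (fun U : GaugeConfig d L G => WilsonRP.plaqRe ρ U (((x, q)) : Plaquette d L)) * wilsonExpectation ρ β (fun U : GaugeConfig d L G => WilsonRP.plaqRe ρ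 U (((y, q')) : Plaquette d L))) ^ 2 ≤ (∑ s ∈ Finset.range 3, |(wilsonExpectation ρ β (fun U : GaugeConfig d L G => WilsonRP.plaqRe ρ U ((((0 : Site d L)), q) : Plaquette d L) * WilsonRP.plaqRe ρ U (((Pi.single (0 : Fin d) (((m - 1 + s : ℕ) : ℕ) : ZMod L), q)) : Plaquette d L)) - wilsonExpectation ρ β (fun U : GaugeConfig d L G => WilsonRP.plaqRe ρ U ((((0 : Site d L)), q) : Plaquette d L)) * wilsonExpectation ρ β (fun U : GaugeConfig d L G => WilsonRP.plaqRe ρ U (((Pi.single (0 : Fin d) (((m - 1 + s : ℕ) : ℕ) : ZMod L), q)) : Plaquette d L)))|) * (∑ s ∈ Finset.range 3, |(wilsonExpectation ρ β (fun U : GaugeConfig d L G => WilsonRP.plaqRe ρ U ((((0 : Site d L)), q') : Plaquette d L) * WilsonRP.plaqRe ρ U (((Pi.single (0 : Fin d) (((m - 1 + s : ℕ) : ℕ) : ZMod L), q')) : Plaquette d L)) - wilsonExpectation ρ β (fun U : GaugeConfig d L G => WilsonRP.plaqRe ρ U ((((0 : Site d L)), q') : Plaquette d L)) * wilsonExpectation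 ρ β (fun U : GaugeConfig d L G => WilsonRP.plaqRe ρ U (((Pi.single (0 : Fin d) (((m - 1 + s : ℕ) : ℕ) : ZMod L), q')) : Plaquette d L)))|) := by
  intro d L N _ _ G _ _ _ _ _ _ ρ hρ β hβ q q' x y m hm1 hmL hΔ
  exact AxisCovNonneg.offAxis_core_pos ρ hρ hβ q q' x y hm1 hmL hΔ

end Summit.QuantumFields.YangMills.Theorems.FemtoCurvatureTwoPoint

end
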